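import Summits.AtomisticToContinuum.Crystallization.Theses.ThreeConeCertificate
import Summits.AtomisticToContinuum.Crystallization.Theorems.ThreeConeCertificateOnePercentCertificateReduction
import Summits.AtomisticToContinuum.Crystallization.Theorems.ThreeConeCertificateOnePercentCertificatePerronGauge
import Summits.AtomisticToContinuum.Crystallization.Theorems.ThreeConeCertificateOnePercentCertificateHardCore

/-!
# `OnePercentCertificate` (stmt-AtomisticToContinuum-11958) — line `perron-gauge`: the crux reduces to C⁺

Line `perron-gauge-Sketch` (skeleton `Cruxes/OnePercentCertificate/Lines/perron_gauge_Sketch.lean`, lead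
prover-line-stmt-AtomisticToContinuum-11958-a1-0).

`onePercentCertificate_of_weightedStability` — **the crux is exactly the operator inequality C⁺** on
hard-core-separated configurations (the line's single remaining registered stub `stub_weightedStability`):
`Σ_{i≠j} v_i v_j att(r_ij) ≤ Σ_i (2cS + Σ_{j≠i} rep(r_ij)) v_i²` for all weights `v` on `1/8`-separated
injective configurations (`att = max (−gS) 0`, `rep = max gS 0`; i.e. `λ_max(Φ(x) − diag D(x)) ≤ 2cS`)
implies `OnePercentCertificate`: with `v ≡ 1` it is `cS`-stability of `gS` on separated configurations
(`PerronGauge.stable_of_weightedStability`, p142535), the hard-core reduction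
(`PerronGauge.local_of_stableOnSeparated`) removes the separation hypothesis, and the tree reduction
`OnePercentReduction.onePercentCertificate_of_local` (p112372) supplies decomposition, slack sign, range,
positive type and value for the split `(cS, gS, US, fS)`.  Certificates of C⁺ for a given configuration are
checked by `PerronGauge.weightedStability_of_gauge` (positive gauge / weighted Schur test). [folklore]
-/

noncomputable section

open scoped BigOperators
open Literature.MathematicalPhysics.StatisticalMechanics
open Summit.AtomisticToContinuum.Crystallization.Theorems
open Summit.AtomisticToContinuum.Crystallization.Theorems.ThreeConeSplit

namespace Summit.AtomisticToContinuum.Crystallization.Theorems.PerronGauge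

/-- **`OnePercentCertificate` follows from the operator inequality C⁺ on `1/8`-separated configurations.**
[folklore] -/
theorem onePercentCertificate_of_weightedStability :
    (∀ (N : ℕ) (x : Fin N → EuclideanSpace ℝ (Fin 3)) (v : Fin N → ℝ), Function.Injective x →
      (∀ i j, i ≠ j → (1 / 8 : ℝ) ≤ dist (x i) (x j)) →
      ∑ i, ∑ j ∈ Finset.univ.erase i, v i * v j * max (-gS (dist (x i) (x j))) 0
        ≤ ∑ i, (2 * cS + ∑ j ∈ Finset.univ.erase i, max (gS (dist (x i) (x j))) 0) * v i ^ 2) →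
    Summit.AtomisticToContinuum.Crystallization.Theses.ThreeConeCertificate.OnePercentCertificate := by
  intro hC
  refine OnePercentReduction.onePercentCertificate_of_local (local_of_stableOnSeparated ?_)
  intro N x hx hsep
  exact stable_of_weightedStability gS cS N x fun v => hC N x v hx hsep

end Summit.AtomisticToContinuum.Crystallization.Theorems.PerronGauge
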